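import Literature.NumberTheory.EllipticCurves.ExceptionalPrimesDensityTransfer
import Literature.NumberTheory.EllipticCurves.BhargavaSkinnerZhang2014.CellUnion
import Literature.NumberTheory.EllipticCurves.QuadraticTwist
import Literature.NumberTheory.EllipticCurves.IsogenyHasCMIffJMemProofs
import Mathlib.Algebra.Order.Ring.Basic
import HarnessLib

/-!
# Thin subfamilies have height density zero: a fixed `j`-invariant, quadratic-twist families, CM curves, finite sets

Elementary counting in the tree's height family `E_{A,B} : y² = x³ + Ax + B` (`HeightFamily.lean`:
`(A, B) ∈ ℤ²`, `4A³ + 27B² ≠ 0`, no prime `q` with `q⁴ ∣ A`, `q⁶ ∣ B`, ordered by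
`H = max(4|A|³, 27B²)`), PROVED from the definitions — no named fact is introduced. This is the
kernel form of the sentence of record of `PERCENT-FULL.md` §(iii) (cell `pub-bsdpct`: "every family on
which BSD(E,2) is proved in print is either finite or a twist family of finitely many `j`-invariants, and
each such family has density 0") and of its §(ii).2 (F2) ("non-CM has density one"):

* `hasHeightDensity_zero_of_card_filter_le` — **polynomially sparse sets have density zero**: if the
  members of height `< Y ≤ X⁶` satisfying `Q` number `≤ c·X⁴` (`X ≥ 1`), then the proportion of `Q`
  tends to `0` (`HasHeightDensity Q 0`), because the family below height `Y` has at least `X₀⁵/4`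
  members for `27·X₀⁶ < Y` (`pow_five_div_four_le_card_heightFamilyBelow`, from the coprime-box count of
  `ExceptionalPrimesDensityTransfer.lean`); and `HasHeightDensity.heightDensityGE_not_of_zero` — the
  complement of a density-zero set has lower density one (the form `HeightDensityGE (¬ Q) 1` consumed by
  `HeightDensityGE.and_of_one`, `HeightDensityLemmas.lean`);
* `shortWeierstrassJ`, `shortWeierstrass_j` — `j(E_{A,B}) = 6912A³/(4A³ + 27B²)` (`= 1728·4A³/(4A³+27B²)`,
  Mathlib's `WeierstrassCurve.j` of the model `[0,0,0,A,B]`);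
* `card_filter_shortWeierstrassJ_eq_le` — **at most `2X³ + 1` curves of height `< Y ≤ X⁶` have a given
  `j`-invariant** (for `j ≠ 1728` the coordinate `B`, `|B| ≤ X³`, determines `A` through
  `(6912 − 4j)A³ = 27jB²`; for `j = 1728`, `B = 0` and `|A| ≤ X²`) — a crude bound (the true counts are
  `≍ Y^{1/6}` for `j ∉ {0, 1728}`, `≍ Y^{1/2}` for `j = 0`, `≍ Y^{1/3}` for `j = 1728`, against
  `#{H < Y} ≍ Y^{5/6}`), sufficient for density ZERO;
* `hasHeightDensity_zero_shortWeierstrassJ_eq`, `heightDensityGE_one_shortWeierstrassJ_ne`,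
  `heightDensityGE_one_forall_shortWeierstrassJ_ne` — a fixed `j`-invariant, and any finite set of
  `j`-invariants, is met with density zero;
* `heightDensityGE_one_not_quadraticTwistFamily` — the curves `E_{A,B}` that are `ℚ`-isomorphic to a
  quadratic twist `E₀^{(d)}` of a FIXED elliptic curve `E₀` (`QuadraticTwist.lean`; they all have
  `j = j(E₀)`, `j_quadraticTwist` + `variableChange_j`) have density zero;
* `card_filter_hasCM_le`, `hasHeightDensity_zero_hasCM`, `heightDensityGE_one_not_hasCM` — **CM curves have
  height density zero, non-CM curves density one**, UNCONDITIONALLY: by the tree THEOREM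
  `WeierstrassCurve.hasCM_iff_j_mem_holds` (`IsogenyHasCMIffJMemProofs.lean`: `E/ℚ` has CM iff `j(E)` is one
  of the thirteen class-number-one values `cmJInvariants`, Silverman *AEC* App. C §11) at most
  `13·(2X³ + 1)` curves of height `< Y ≤ X⁶` have CM;
* `hasHeightDensity_zero_mem_finset`, `heightDensityGE_one_not_mem_finset`,
  `heightDensityGE_one_not_mem_of_finite` — a finite set of pairs has density zero (the conductor-bounded
  families of §(iii)(a), once known to be finite);
* `HeightDensityGE.and_not_hasCM`, `HeightDensityGE.and_shortWeierstrassJ_ne` — removing the CM curves, or a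
  fixed-`j` family, from a set of lower density `δ` keeps lower density `δ` (the algebra (L) of
  `PERCENT-FULL.md` §(ii).2).

## Source

A. Barquero-Sanchez, J. Calvo-Monge, *The density and distribution of CM elliptic curves over `ℚ`*,
J. Math. Anal. Appl. 546 (2025) 129192 = arXiv:2411.13526 [BarqueroSanchezCalvoMonge2025] (read in the held
arXiv text, `paper:arxiv-2411.13526`). It works in EXACTLY the tree's family — §1: "the family `𝓔` consisting of
all elliptic curves `E_{A,B}` given by the equation `y² = x³ + Ax + B`, where `A, B ∈ ℤ` satisfy the condition
`Δ_{E_{A,B}} = −16(4A³ + 27B²) ≠ 0`, and there exists no prime number `p` such that `p⁴ | A` and `p⁶ | B`",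
naive height `h(E_{A,B}) := max{4|A|³, 27|B|²}`, `𝓔(X) := {h ≤ X}`, natural density
`d(𝓢) := lim #(𝓔(X) ∩ 𝓢)/#𝓔(X)` (the tree's `heightFamilyBelow X` uses `h < X` and `X ∈ ℕ`, immaterial
for the statements below) — and proves: Thm 1.1 (= Thm 2.5) "The natural density of the set of CM elliptic
curves `𝓔^cm` in the family `𝓔` is `d(𝓔^cm) = 0`"; Thm 1.2 (Brumer) `#𝓔(X) = (2^{4/3}/(3^{3/2}ζ(10))) X^{5/6}
+ O(X^{7/12})`; Thm 1.6 (= Thm 2.4) "Let `j ∈ ℚ`. Then `#𝓔_j(X) = O(X^{1/m(j)})`, `m(j) = 6` if `j ≠ 0, 1728`,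
`3` if `j = 1728`, `2` if `j = 0`", with the proof's identities `j(E_{A,B}) = 1728·4A³/(4A³ + 27B²)`, "`j = 0`
iff `A = 0`, `j = 1728` iff `B = 0`", `B² = ((1728 − 4j)/(27j))A³` for `j ≠ 0, 1728`; §3 (twists `E_D` of a
fixed `E`, Lemma 3.4). WHAT IS PROVED HERE is the density-ZERO content of these theorems with CRUDE
polynomial bounds (`≤ 2X³ + 1` curves of a given `j` below height `X⁶`, i.e. `O(h^{1/2})`, against
`#𝓔 ≥ X₀⁵/4`), not the printed asymptotics / exponents `1/m(j)` (the paper's Lemma (technical lemma) on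
integral points of `y² = a x³` is not formalised — a shorter road suffices for density `0`). The input
"`E/ℚ` has CM iff `j(E)` is one of the thirteen rational CM invariants" (the paper's `𝓔^cm = ∐_{j ∈ 𝓙^cm} 𝓔_j`,
Silverman *AEC* App. C §11 [SilvermanAEC2009]) is the tree THEOREM `WeierstrassCurve.hasCM_iff_j_mem_holds`.
Use in `PERCENT-FULL.md`: the algebra "a density-zero subfamily may be discarded" of Bhargava–Skinner–Zhang,
arXiv:1407.1826 §3 [BhargavaSkinnerZhang2014].
-/

namespace Literature.NumberTheory.EllipticCurves

open scoped Classical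
open Filter Topology Finset WeierstrassCurve

/-! ### Complements: a density-zero set has a density-one complement -/

/-- Complementary proportions add up to `1` once the family below height `X` is nonempty (`X ≥ 28`,
`zeroOne_mem_heightFamilyBelow`): `d(𝓔 ∖ 𝓢) = 1 − d(𝓢)` at finite level. [cite: BarqueroSanchezCalvoMonge2025, §1 (natural density d(𝓢) = lim #(𝓔(X) ∩ 𝓢)/#𝓔(X))] -/
theorem heightProportion_compl_add (P : ℤ × ℤ → Prop) {X : ℕ} (hX : 28 ≤ X) :
    heightProportion (fun AB ↦ ¬ P AB) X + heightProportion P X = 1 := by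
  have hpos : (0 : ℝ) < (heightFamilyBelow X).card := by
    exact_mod_cast Finset.card_pos.mpr ⟨_, zeroOne_mem_heightFamilyBelow hX⟩
  unfold heightProportion heightAverage
  rw [← add_div, ← Finset.sum_add_distrib, div_eq_one_iff_eq hpos.ne', Finset.card_eq_sum_ones,
    Nat.cast_sum]
  refine Finset.sum_congr rfl fun AB _ ↦ ?_
  by_cases hP : P AB <;> simp [hP]

/-- **The complement of a density-zero set has (lower) density one**: if the proportion of curves of
height `< X` satisfying `Q` tends to `0` (`HasHeightDensity Q 0`, the paper's `d(𝓢) = 0`), then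
`HeightDensityGE (¬ Q) 1` — the form in which density-zero sets are removed (`HeightDensityGE.and_of_one`).
[cite: BarqueroSanchezCalvoMonge2025, §1 (natural density d(𝓢))] -/
theorem HasHeightDensity.heightDensityGE_not_of_zero {Q : ℤ × ℤ → Prop} (h : HasHeightDensity Q 0) :
    HeightDensityGE (fun AB ↦ ¬ Q AB) 1 := by
  intro ε hε
  have hev : ∀ᶠ X : ℕ in atTop, heightProportion Q X < ε := h.eventually (gt_mem_nhds hε)
  filter_upwards [hev, eventually_ge_atTop 28] with X hX hX28
  have := heightProportion_compl_add Q hX28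
  linarith

/-! ### The family below height `Y` is not too small, and its members have small coordinates -/

/-- **Polynomial lower bound for the family**: `X⁵/4 ≤ #{E_{A,B} : H < Y}` whenever `27·X⁶ < Y`
(Duke's box `max(|A|³, B²) ≤ X⁶` lies below height `Y` and contains the `≥ X⁵/4` coprime pairs
`(A, B) ∈ [1, X²] × [1, X³]`; `ExceptionalPrimesDensityTransfer.lean`). Only this crude form of Brumer's
`#𝓔(X) = (2^{4/3}/(3^{3/2}ζ(10))) X^{5/6} + O(X^{7/12})` is proved. [cite: BarqueroSanchezCalvoMonge2025, Thm 1.2 (Brumer; crude lower bound only)] -/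
theorem pow_five_div_four_le_card_heightFamilyBelow {X Y : ℕ} (h : 27 * X ^ 6 < Y) :
    (X : ℝ) ^ 5 / 4 ≤ (heightFamilyBelow Y).card :=
  le_trans (card_dukeFamily_ge X)
    (by exact_mod_cast Finset.card_le_card (dukeFamily_subset_heightFamilyBelow h))

/-- Coordinates below height `Y ≤ X⁶` are small: `|A| ≤ X²` and `|B| ≤ X³` (`4|A|³ < Y`, `27B² < Y`); the
paper's box "`h(E_{A,B}) ≤ X` if and only if `|A| ≤ X^{1/3}/2^{2/3}` and `|B| ≤ X^{1/2}/3^{3/2}`" in integers.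
[cite: BarqueroSanchezCalvoMonge2025, §2 eq. (AB-bounds) (integer form)] -/
theorem abs_le_of_mem_heightFamilyBelow {X Y : ℕ} (hYX : Y ≤ X ^ 6) {AB : ℤ × ℤ}
    (hAB : AB ∈ heightFamilyBelow Y) : |AB.1| ≤ (X : ℤ) ^ 2 ∧ |AB.2| ≤ (X : ℤ) ^ 3 := by
  have h := heightFamilyBelow_subset_dukeFamily hYX hAB
  rw [mem_dukeFamily_iff] at h
  exact (dukeHeight_le_iff AB X).mp h.2

/-! ### Polynomially sparse sets have density zero -/

/-- **Sparse sets have height density zero.** If for some constant `c` and every `X ≥ 1`, `Y ≤ X⁶`, at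
most `c·X⁴` members of the family of height `< Y` satisfy `Q`, then the proportion of `Q` tends to `0`.
(Any exponent `< 5` would do: with `X₁` least such that `Y ≤ X₁⁶` and `X₀ = ⌊(X₁ − 1)/2⌋` one has
`27·X₀⁶ < Y`, `X₁ ≤ 4X₀`, so the proportion is `≤ c·(4X₀)⁴ / (X₀⁵/4) = 1024c/X₀ → 0`.) This is the mechanism
of the paper's proof of Thm 2.5 (`O(X^{1/2})` against `≍ X^{5/6}`), with crude constants.
[cite: BarqueroSanchezCalvoMonge2025, Thm 2.5 (proof: a count O(X^{1/2}) has natural density 0 by Thm 1.2)] -/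
theorem hasHeightDensity_zero_of_card_filter_le {Q : ℤ × ℤ → Prop} [DecidablePred Q] (c : ℝ)
    (h : ∀ X Y : ℕ, 1 ≤ X → Y ≤ X ^ 6 →
      (((heightFamilyBelow Y).filter Q).card : ℝ) ≤ c * (X : ℝ) ^ 4) :
    HasHeightDensity Q 0 := by
  show Tendsto (heightProportion Q) atTop (𝓝 0)
  refine tendsto_order.2 ⟨fun a ha ↦ Eventually.of_forall fun X ↦
    lt_of_lt_of_le ha (heightProportion_nonneg Q X), fun ε hε ↦ ?_⟩
  -- constants: c' = max c 1 > 0, M > 1024 c'/ε, M' = max (2M) 2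
  set c' : ℝ := max c 1 with hc'
  have hc'1 : (1 : ℝ) ≤ c' := le_max_right _ _
  have hcc' : c ≤ c' := le_max_left _ _
  have hc'pos : (0 : ℝ) < c' := by linarith
  obtain ⟨M, hM⟩ := exists_nat_gt (1024 * c' / ε)
  set M' : ℕ := max (2 * M) 2 with hM'
  have hM'2 : 2 ≤ M' := le_max_right _ _
  have hM'M : 2 * M ≤ M' := le_max_left _ _
  rw [eventually_atTop]
  refine ⟨max 28 (M' ^ 6 + 1), fun Y hY ↦ ?_⟩
  have hY28 : 28 ≤ Y := le_trans (le_max_left _ _) hY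
  have hYM : M' ^ 6 < Y := lt_of_lt_of_le (Nat.lt_succ_self _) (le_trans (le_max_right _ _) hY)
  -- X₁ := the least X with Y ≤ X⁶
  have hex : ∃ X : ℕ, Y ≤ X ^ 6 := ⟨Y, Nat.le_self_pow (by norm_num) Y⟩
  obtain ⟨X₁, hX₁spec, hX₁min⟩ : ∃ X₁ : ℕ, Y ≤ X₁ ^ 6 ∧ ∀ X < X₁, ¬ Y ≤ X ^ 6 :=
    ⟨Nat.find hex, Nat.find_spec hex, fun X hX ↦ Nat.find_min hex hX⟩
  have hX₁M : M' < X₁ := by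
    by_contra hcon
    have h' : X₁ ≤ M' := not_lt.mp hcon
    have : X₁ ^ 6 ≤ M' ^ 6 := Nat.pow_le_pow_left h' 6
    omega
  have hX₁3 : 3 ≤ X₁ := by omega
  have hX₁min' : (X₁ - 1) ^ 6 < Y := by
    have := hX₁min (X₁ - 1) (by omega)
    omega
  -- X₀ := ⌊(X₁ − 1)/2⌋
  set X₀ : ℕ := (X₁ - 1) / 2 with hX₀
  have hX₀1 : 1 ≤ X₀ := by omega
  have hX₀M : M ≤ X₀ := by omega
  have hX₁le : X₁ ≤ 4 * X₀ := by omega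
  have h27 : 27 * X₀ ^ 6 < Y := by
    have h2 : 2 * X₀ ≤ X₁ - 1 := by omega
    have h3 : (2 * X₀) ^ 6 ≤ (X₁ - 1) ^ 6 := Nat.pow_le_pow_left h2 6
    have h4 : (2 * X₀) ^ 6 = 64 * X₀ ^ 6 := by ring
    omega
  -- denominator ≥ X₀⁵/4, numerator ≤ c'·X₁⁴ ≤ 256 c'·X₀⁴
  have hden : (X₀ : ℝ) ^ 5 / 4 ≤ (heightFamilyBelow Y).card := pow_five_div_four_le_card_heightFamilyBelow h27
  have hnum : (((heightFamilyBelow Y).filter Q).card : ℝ) ≤ c' * (X₁ : ℝ) ^ 4 :=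
    le_trans (h X₁ Y (by omega) hX₁spec) (mul_le_mul_of_nonneg_right hcc' (by positivity))
  have hX₁le' : (X₁ : ℝ) ≤ 4 * (X₀ : ℝ) := by exact_mod_cast hX₁le
  have hx0 : (1 : ℝ) ≤ X₀ := by exact_mod_cast hX₀1
  have hx0M : (M : ℝ) ≤ X₀ := by exact_mod_cast hX₀M
  have hnum' : (((heightFamilyBelow Y).filter Q).card : ℝ) ≤ 256 * c' * (X₀ : ℝ) ^ 4 := by
    have h4 : (X₁ : ℝ) ^ 4 ≤ (4 * (X₀ : ℝ)) ^ 4 := pow_le_pow_left₀ (by positivity) hX₁le' 4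
    have h5 : c' * (X₁ : ℝ) ^ 4 ≤ c' * (4 * (X₀ : ℝ)) ^ 4 := mul_le_mul_of_nonneg_left h4 hc'pos.le
    have e : c' * (4 * (X₀ : ℝ)) ^ 4 = 256 * c' * (X₀ : ℝ) ^ 4 := by ring
    linarith
  have hFpos : (0 : ℝ) < (heightFamilyBelow Y).card := by
    exact_mod_cast Finset.card_pos.mpr ⟨_, zeroOne_mem_heightFamilyBelow hY28⟩
  -- 1024 c' < ε·X₀ since X₀ ≥ M > 1024 c'/ε
  have hkey : 1024 * c' < ε * (X₀ : ℝ) := by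
    have h1 : 1024 * c' / ε < X₀ := lt_of_lt_of_le hM hx0M
    have h2 : 1024 * c' < (X₀ : ℝ) * ε := (div_lt_iff₀ hε).mp h1
    linarith [mul_comm (X₀ : ℝ) ε]
  rw [heightProportion_eq_card_div, div_lt_iff₀ hFpos]
  calc (((heightFamilyBelow Y).filter Q).card : ℝ) ≤ 256 * c' * (X₀ : ℝ) ^ 4 := hnum'
    _ = (1024 * c') * ((X₀ : ℝ) ^ 4 / 4) := by ring
    _ < (ε * (X₀ : ℝ)) * ((X₀ : ℝ) ^ 4 / 4) := mul_lt_mul_of_pos_right hkey (by positivity)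
    _ = ε * ((X₀ : ℝ) ^ 5 / 4) := by ring
    _ ≤ ε * (heightFamilyBelow Y).card := mul_le_mul_of_nonneg_left hden hε.le

/-- Sparse sets, complement form: under the hypothesis of `hasHeightDensity_zero_of_card_filter_le` the
complement of `Q` has (lower) height density one. [cite: BarqueroSanchezCalvoMonge2025, Thm 2.5 (proof mechanism) and §1 (natural density)] -/
theorem heightDensityGE_one_not_of_card_filter_le {Q : ℤ × ℤ → Prop} [DecidablePred Q] (c : ℝ)
    (h : ∀ X Y : ℕ, 1 ≤ X → Y ≤ X ^ 6 →
      (((heightFamilyBelow Y).filter Q).card : ℝ) ≤ c * (X : ℝ) ^ 4) :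
    HeightDensityGE (fun AB ↦ ¬ Q AB) 1 :=
  (hasHeightDensity_zero_of_card_filter_le c h).heightDensityGE_not_of_zero

/-! ### Finite sets have density zero -/

/-- **A finite set of pairs has height density zero** (immediate from the definition of natural density,
`#𝓔(X) → ∞`). [cite: BarqueroSanchezCalvoMonge2025, §1 (natural density d(𝓢); Thm 1.2 gives #𝓔(X) → ∞)] -/
theorem hasHeightDensity_zero_mem_finset (S : Finset (ℤ × ℤ)) :
    HasHeightDensity (fun AB ↦ AB ∈ S) 0 :=
  hasHeightDensity_zero_of_card_filter_le S.card fun X Y hX _ ↦ by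
    have h1 : ((heightFamilyBelow Y).filter fun AB ↦ AB ∈ S).card ≤ S.card :=
      Finset.card_le_card fun AB h ↦ (Finset.mem_filter.mp h).2
    have h1' : (((heightFamilyBelow Y).filter fun AB ↦ AB ∈ S).card : ℝ) ≤ S.card := by
      exact_mod_cast h1
    have hX' : (1 : ℝ) ≤ X := by exact_mod_cast hX
    have h2 : (S.card : ℝ) ≤ S.card * (X : ℝ) ^ 4 :=
      le_mul_of_one_le_right (Nat.cast_nonneg _) (one_le_pow₀ hX')
    linarith

/-- The complement of a finite set of pairs has (lower) height density one. [cite: BarqueroSanchezCalvoMonge2025, §1 (natural density d(𝓢))] -/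
theorem heightDensityGE_one_not_mem_finset (S : Finset (ℤ × ℤ)) :
    HeightDensityGE (fun AB ↦ AB ∉ S) 1 :=
  (hasHeightDensity_zero_mem_finset S).heightDensityGE_not_of_zero

/-- The complement of a finite set of pairs has (lower) height density one (`Set.Finite` form: e.g. a
conductor-bounded family, once known to be finite). [cite: BarqueroSanchezCalvoMonge2025, §1 (natural density d(𝓢))] -/
theorem heightDensityGE_one_not_mem_of_finite {S : Set (ℤ × ℤ)} (hS : S.Finite) :
    HeightDensityGE (fun AB ↦ AB ∉ S) 1 := by
  have h := heightDensityGE_one_not_mem_finset hS.toFinset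
  have e : (fun AB : ℤ × ℤ ↦ AB ∉ hS.toFinset) = fun AB ↦ AB ∉ S := by
    funext AB
    simp [Set.Finite.mem_toFinset]
  rw [e] at h
  exact h

/-! ### The `j`-invariant of `E_{A,B}` -/

/-- The `j`-invariant of `E_{A,B} : y² = x³ + Ax + B` as a rational function of `(A, B)`:
`j(E_{A,B}) = c₄³/Δ = (−48A)³/(−16(4A³ + 27B²)) = 6912A³/(4A³ + 27B²) = 1728 · 4A³/(4A³ + 27B²)`
(junk value when `4A³ + 27B² = 0`); the paper's "the `j`-invariant of `E_{A,B}` is given by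
`j(E_{A,B}) = 1728 · 4A³/(4A³ + 27B²)`" (proof of Thm 2.4). [cite: BarqueroSanchezCalvoMonge2025, Thm 2.4 (proof, formula for j(E_{A,B}))] [cite: SilvermanAEC2009, §III.1 (c₄, Δ, j = c₄³/Δ)] -/
def shortWeierstrassJ (AB : ℤ × ℤ) : ℚ :=
  6912 * (AB.1 : ℚ) ^ 3 / (4 * (AB.1 : ℚ) ^ 3 + 27 * (AB.2 : ℚ) ^ 2)

/-- Unfolding lemma for `shortWeierstrassJ`: `j(E_{A,B}) = 6912A³/(4A³ + 27B²) = 1728·4A³/(4A³ + 27B²)`.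
[cite: BarqueroSanchezCalvoMonge2025, Thm 2.4 (proof, formula for j(E_{A,B}))] -/
theorem shortWeierstrassJ_def (AB : ℤ × ℤ) :
    shortWeierstrassJ AB = 6912 * (AB.1 : ℚ) ^ 3 / (4 * (AB.1 : ℚ) ^ 3 + 27 * (AB.2 : ℚ) ^ 2) := rfl

/-- `c₄(E_{A,B}) = −48A` (`b₂ = 0`, `b₄ = 2A`, `c₄ = b₂² − 24b₄`). [cite: SilvermanAEC2009, §III.1 (c₄ = b₂² − 24 b₄)] -/
theorem shortWeierstrass_c₄ (AB : ℤ × ℤ) : (shortWeierstrass AB).c₄ = -48 * (AB.1 : ℚ) := by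
  simp only [shortWeierstrass, WeierstrassCurve.c₄, WeierstrassCurve.b₂, WeierstrassCurve.b₄]
  ring

/-- `Δ(E_{A,B}) = −16(4A³ + 27B²)` (local copy of `shortWeierstrass_Δ` of `HeightFamilyProofs.lean`, to
keep the imports of this file small). [cite: SilvermanAEC2009, §III.1] -/
private theorem shortWeierstrass_Δ_eq (AB : ℤ × ℤ) :
    (shortWeierstrass AB).Δ = -16 * (4 * (AB.1 : ℚ) ^ 3 + 27 * (AB.2 : ℚ) ^ 2) := by
  simp only [shortWeierstrass, WeierstrassCurve.Δ, WeierstrassCurve.b₂, WeierstrassCurve.b₄,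
    WeierstrassCurve.b₆, WeierstrassCurve.b₈]
  ring

/-- **Mathlib's `j` of `E_{A,B}` is `shortWeierstrassJ (A, B)`** whenever `E_{A,B}` is elliptic (any
instance; e.g. `isElliptic_shortWeierstrass` for members of the family): `j = c₄³/Δ = (−48A)³/(−16(4A³ + 27B²))`.
[cite: BarqueroSanchezCalvoMonge2025, Thm 2.4 (proof: j(E_{A,B}) = 1728·4A³/(4A³+27B²))] [cite: SilvermanAEC2009, §III.1 (j = c₄³/Δ)] -/
theorem shortWeierstrass_j (AB : ℤ × ℤ) [(shortWeierstrass AB).IsElliptic] :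
    (shortWeierstrass AB).j = shortWeierstrassJ AB := by
  have hΔ := shortWeierstrass_Δ_eq AB
  have hD : (4 * (AB.1 : ℚ) ^ 3 + 27 * (AB.2 : ℚ) ^ 2) ≠ 0 := by
    intro h0
    have hu := (shortWeierstrass AB).isUnit_Δ
    rw [hΔ, h0, mul_zero] at hu
    exact not_isUnit_zero hu
  rw [WeierstrassCurve.j, Units.val_inv_eq_inv_val, WeierstrassCurve.coe_Δ', hΔ, shortWeierstrass_c₄,
    shortWeierstrassJ]
  field_simp
  ring

/-- In the family, `j(E_{A,B}) = 1728` forces `B = 0` (`6912A³ = 1728(4A³ + 27B²)` gives `B² = 0`); the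
paper: "`j(E_{A,B}) = 1728` if and only if `B = 0`" (only this direction is needed).
[cite: BarqueroSanchezCalvoMonge2025, Thm 2.4 (proof: j = 1728 iff B = 0)] -/
theorem snd_eq_zero_of_shortWeierstrassJ_eq {AB : ℤ × ℤ} (hf : IsInHeightFamily AB)
    (hj : shortWeierstrassJ AB = 1728) : AB.2 = 0 := by
  have hD : (4 * (AB.1 : ℚ) ^ 3 + 27 * (AB.2 : ℚ) ^ 2) ≠ 0 := by exact_mod_cast hf.1
  rw [shortWeierstrassJ, div_eq_iff hD] at hj
  have h2 : (AB.2 : ℚ) ^ 2 = 0 := by linarith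
  have hB : (AB.2 : ℚ) = 0 := (pow_eq_zero_iff two_ne_zero).mp h2
  exact_mod_cast hB

/-- In the family, two pairs with the same second coordinate `B` and the same `j`-invariant `j₀ ≠ 1728`
have the same `A`: `(6912 − 4j₀)A³ = 27j₀B²` determines `A³`, and cubing is injective on `ℚ` — the paper's
"`j(E_{A,B}) = j ⟺ B² = ((1728 − 4j)/(27j)) A³`" for `j ≠ 0, 1728` (and `A = 0` for `j = 0`).
[cite: BarqueroSanchezCalvoMonge2025, Thm 2.4 (proof: B² = (1728−4j)/(27j)·A³)] -/
theorem fst_eq_of_shortWeierstrassJ_eq {AB AB' : ℤ × ℤ} (hf : IsInHeightFamily AB)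
    (hf' : IsInHeightFamily AB') {j₀ : ℚ} (hj₀ : j₀ ≠ 1728) (hj : shortWeierstrassJ AB = j₀)
    (hj' : shortWeierstrassJ AB' = j₀) (hB : AB.2 = AB'.2) : AB.1 = AB'.1 := by
  have hD : (4 * (AB.1 : ℚ) ^ 3 + 27 * (AB.2 : ℚ) ^ 2) ≠ 0 := by exact_mod_cast hf.1
  have hD' : (4 * (AB'.1 : ℚ) ^ 3 + 27 * (AB'.2 : ℚ) ^ 2) ≠ 0 := by exact_mod_cast hf'.1
  rw [shortWeierstrassJ, div_eq_iff hD] at hj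
  rw [shortWeierstrassJ, div_eq_iff hD'] at hj'
  have hB' : (AB.2 : ℚ) = AB'.2 := by exact_mod_cast hB
  rw [hB'] at hj
  have h3 : (6912 - 4 * j₀) * ((AB.1 : ℚ) ^ 3 - (AB'.1 : ℚ) ^ 3) = 0 := by
    linear_combination hj - hj'
  have hne : (6912 - 4 * j₀ : ℚ) ≠ 0 := by
    intro h0
    apply hj₀
    linarith
  have hcube : (AB.1 : ℚ) ^ 3 = (AB'.1 : ℚ) ^ 3 := by
    rcases mul_eq_zero.mp h3 with h0 | h0
    · exact absurd h0 hne
    · linarith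
  have hodd : Odd 3 := ⟨1, by norm_num⟩
  have hinj := (Odd.strictMono_pow (R := ℚ) hodd).injective
  have h1 : (AB.1 : ℚ) = AB'.1 := hinj hcube
  exact_mod_cast h1

/-! ### A fixed `j`-invariant is met with density zero -/

/-- **At most `2X³ + 1` curves of height `< Y ≤ X⁶` have `j`-invariant `j₀`.** For `j₀ = 1728` they have
`B = 0` and are determined by `A`, `|A| ≤ X² ≤ X³`; for `j₀ ≠ 1728` they are determined by `B`,
`|B| ≤ X³`. A CRUDE form (`O(h^{1/2})` below height `h`) of the paper's Thm 1.6 = Thm 2.4,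
"`#𝓔_j(X) = O(X^{1/m(j)})`, `m(j) = 6, 3, 2` for `j ≠ 0, 1728`, `j = 1728`, `j = 0`"; the sharper exponents
(its Lemma on integral points of `y² = a x³`) are not formalised. [cite: BarqueroSanchezCalvoMonge2025, Thm 1.6 (= Thm 2.4; crude bound only)] -/
theorem card_filter_shortWeierstrassJ_eq_le (j₀ : ℚ) {X Y : ℕ} (hYX : Y ≤ X ^ 6) :
    ((heightFamilyBelow Y).filter fun AB ↦ shortWeierstrassJ AB = j₀).card ≤ 2 * X ^ 3 + 1 := by
  set S := (heightFamilyBelow Y).filter fun AB ↦ shortWeierstrassJ AB = j₀ with hS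
  have hmem : ∀ AB ∈ S, IsInHeightFamily AB ∧ shortWeierstrassJ AB = j₀ ∧
      |AB.1| ≤ (X : ℤ) ^ 2 ∧ |AB.2| ≤ (X : ℤ) ^ 3 := by
    intro AB hAB
    rw [hS, Finset.mem_filter] at hAB
    exact ⟨((mem_heightFamilyBelow_iff AB Y).mp hAB.1).1, hAB.2,
      abs_le_of_mem_heightFamilyBelow hYX hAB.1⟩
  have hcardI : (Finset.Icc (-((X : ℤ) ^ 3)) ((X : ℤ) ^ 3)).card = 2 * X ^ 3 + 1 := by
    rw [Int.card_Icc]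
    have e : ((X : ℤ) ^ 3 + 1 - -((X : ℤ) ^ 3)) = ((2 * X ^ 3 + 1 : ℕ) : ℤ) := by push_cast; ring
    rw [e, Int.toNat_natCast]
  rw [← hcardI]
  have hX23 : (X : ℤ) ^ 2 ≤ (X : ℤ) ^ 3 := by
    rcases Nat.eq_zero_or_pos X with h0 | hpos
    · simp [h0]
    · exact pow_le_pow_right₀ (by exact_mod_cast hpos) (by norm_num)
  by_cases h1728 : j₀ = 1728
  · -- every member has `B = 0`: inject by the first coordinate
    refine Finset.card_le_card_of_injOn (fun AB ↦ AB.1) ?_ ?_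
    · intro AB hAB
      obtain ⟨-, -, hA, -⟩ := hmem AB (Finset.mem_coe.mp hAB)
      exact Finset.mem_coe.mpr (Finset.mem_Icc.mpr (abs_le.mp (le_trans hA hX23)))
    · intro AB hAB AB' hAB' h
      obtain ⟨hf, hj, -, -⟩ := hmem AB (Finset.mem_coe.mp hAB)
      obtain ⟨hf', hj', -, -⟩ := hmem AB' (Finset.mem_coe.mp hAB')
      have hB := snd_eq_zero_of_shortWeierstrassJ_eq hf (hj.trans h1728)
      have hB' := snd_eq_zero_of_shortWeierstrassJ_eq hf' (hj'.trans h1728)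
      exact Prod.ext h (by rw [hB, hB'])
  · -- `j₀ ≠ 1728`: inject by the second coordinate
    refine Finset.card_le_card_of_injOn (fun AB ↦ AB.2) ?_ ?_
    · intro AB hAB
      obtain ⟨-, -, -, hB⟩ := hmem AB (Finset.mem_coe.mp hAB)
      exact Finset.mem_coe.mpr (Finset.mem_Icc.mpr (abs_le.mp hB))
    · intro AB hAB AB' hAB' h
      obtain ⟨hf, hj, -, -⟩ := hmem AB (Finset.mem_coe.mp hAB)
      obtain ⟨hf', hj', -, -⟩ := hmem AB' (Finset.mem_coe.mp hAB')
      exact Prod.ext (fst_eq_of_shortWeierstrassJ_eq hf hf' h1728 hj hj' h) h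

/-- **A fixed `j`-invariant is met with height density zero**: `d(𝓔_j) = 0` for every `j ∈ ℚ` (from
Thm 1.6's `O(X^{1/m(j)})` — here the crude `O(X^{1/2})` — against Thm 1.2's `≍ X^{5/6}`, as in the proof of
Thm 2.5). [cite: BarqueroSanchezCalvoMonge2025, Thm 1.6 with Thm 1.2 (d(𝓔_j) = 0, proof of Thm 2.5)] -/
theorem hasHeightDensity_zero_shortWeierstrassJ_eq (j₀ : ℚ) :
    HasHeightDensity (fun AB ↦ shortWeierstrassJ AB = j₀) 0 :=
  hasHeightDensity_zero_of_card_filter_le 3 fun X Y hX hYX ↦ by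
    have h : (((heightFamilyBelow Y).filter fun AB ↦ shortWeierstrassJ AB = j₀).card : ℝ)
        ≤ 2 * (X : ℝ) ^ 3 + 1 := by
      exact_mod_cast card_filter_shortWeierstrassJ_eq_le j₀ hYX
    have hX' : (1 : ℝ) ≤ X := by exact_mod_cast hX
    have p3 : (X : ℝ) ^ 3 ≤ (X : ℝ) ^ 4 := pow_le_pow_right₀ hX' (by norm_num)
    have p0 : (1 : ℝ) ≤ (X : ℝ) ^ 4 := one_le_pow₀ hX'
    linarith

/-- The curves with `j`-invariant different from a fixed `j₀` have (lower) height density one (`d(𝓔_{j₀}) = 0`).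
[cite: BarqueroSanchezCalvoMonge2025, Thm 1.6 with Thm 1.2 (d(𝓔_j) = 0)] -/
theorem heightDensityGE_one_shortWeierstrassJ_ne (j₀ : ℚ) :
    HeightDensityGE (fun AB ↦ shortWeierstrassJ AB ≠ j₀) 1 :=
  (hasHeightDensity_zero_shortWeierstrassJ_eq j₀).heightDensityGE_not_of_zero

/-- The curves whose `j`-invariant avoids a FINITE set `J` have (lower) height density one ("a twist
family of finitely many `j`-invariants has density zero"; the paper's `∐_{j ∈ 𝓙} 𝓔_j` for finite `𝓙`).
[cite: BarqueroSanchezCalvoMonge2025, Thm 1.6 with Thm 1.2 (d(∐_{j ∈ 𝓙} 𝓔_j) = 0 for finite 𝓙, as for 𝓙^cm in Thm 2.5)] -/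
theorem heightDensityGE_one_forall_shortWeierstrassJ_ne (J : Finset ℚ) :
    HeightDensityGE (fun AB ↦ ∀ j₀ ∈ J, shortWeierstrassJ AB ≠ j₀) 1 :=
  HeightDensityGE.finset_forall_one J (fun j₀ AB ↦ shortWeierstrassJ AB ≠ j₀)
    fun j₀ _ ↦ heightDensityGE_one_shortWeierstrassJ_ne j₀

/-- Removing a fixed-`j` family from a set of lower density `δ` keeps lower density `δ`.
[cite: BarqueroSanchezCalvoMonge2025, Thm 1.6 with Thm 1.2 (d(𝓔_j) = 0)] [cite: BhargavaSkinnerZhang2014, §3 (discarding a density-zero set)] -/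
theorem HeightDensityGE.and_shortWeierstrassJ_ne {P : ℤ × ℤ → Prop} {δ : ℝ} (hP : HeightDensityGE P δ)
    (j₀ : ℚ) : HeightDensityGE (fun AB ↦ P AB ∧ shortWeierstrassJ AB ≠ j₀) δ :=
  hP.and_of_one (heightDensityGE_one_shortWeierstrassJ_ne j₀)

/-! ### Quadratic-twist families have density zero -/

/-- Transport of `j` along an equality of curves (the two `IsElliptic` instances are proofs of a
proposition; plumbing). [folklore] -/
private theorem j_congr {F : Type*} [Field F] {W W' : WeierstrassCurve F} [W.IsElliptic]
    [W'.IsElliptic] (h : W = W') : W.j = W'.j := by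
  subst h
  rfl

/-- A member `E_{A,B}` of the height family that is `ℚ`-isomorphic to a quadratic twist `E₀^{(d)}`
(`d ≠ 0`) of an elliptic curve `E₀` has `j(E_{A,B}) = j(E₀)` (`variableChange_j`, `j_quadraticTwist`; the
paper's §3: the twists `E_D` of `E` are the curves with `j(E_D) = j(E)`).
[cite: BarqueroSanchezCalvoMonge2025, §3 (twists of a fixed E, Lemma 3.4)] [cite: SilvermanAEC2009, X.5 Cor. 5.4 and III.1 Prop. 1.4(b)] -/
theorem shortWeierstrassJ_eq_of_quadraticTwist (E₀ : WeierstrassCurve ℚ) [E₀.IsElliptic] {AB : ℤ × ℤ}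
    (hf : IsInHeightFamily AB) {d : ℚ} (hd : d ≠ 0) {C : VariableChange ℚ}
    (hC : C • E₀.quadraticTwist d = shortWeierstrass AB) : shortWeierstrassJ AB = E₀.j := by
  haveI := isElliptic_shortWeierstrass hf
  haveI := E₀.isElliptic_quadraticTwist hd
  rw [← shortWeierstrass_j AB, ← j_congr hC, variableChange_j, E₀.j_quadraticTwist hd]

/-- **A quadratic-twist family has height density zero**: for a fixed elliptic curve `E₀/ℚ`, the curves
`E_{A,B}` of the family that are `ℚ`-isomorphic to some quadratic twist `E₀^{(d)}`, `d ∈ ℚ^×`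
(`WeierstrassCurve.quadraticTwist`), form a set whose complement has (lower) density one — they all have
`j = j(E₀)`. (For `j(E₀) ∉ {0, 1728}` this set is the whole fixed-`j` family; the sextic resp. quartic
twists of `j = 0`, `1728` are covered by `heightDensityGE_one_shortWeierstrassJ_ne` directly.)
[cite: BarqueroSanchezCalvoMonge2025, Thm 1.6 with §3 (the twist family of E lies in 𝓔_{j(E)}, d(𝓔_j) = 0)] -/
theorem heightDensityGE_one_not_quadraticTwistFamily (E₀ : WeierstrassCurve ℚ) [E₀.IsElliptic] :
    HeightDensityGE (fun AB ↦ ¬ ∃ d : ℚ, d ≠ 0 ∧ ∃ C : VariableChange ℚ,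
      C • E₀.quadraticTwist d = shortWeierstrass AB) 1 := by
  have h1 : HeightDensityGE (fun AB ↦ shortWeierstrassJ AB ≠ E₀.j ∧ IsInHeightFamily AB) 1 :=
    (heightDensityGE_one_shortWeierstrassJ_ne E₀.j).and_forall fun _ h ↦ h
  refine BhargavaSkinnerZhang2014.HeightDensityGE.mono (fun AB hAB hex ↦ ?_) h1
  obtain ⟨hj, hf⟩ := hAB
  obtain ⟨d, hd, C, hC⟩ := hex
  exact hj (shortWeierstrassJ_eq_of_quadraticTwist E₀ hf hd hC)

/-! ### CM curves have density zero; non-CM curves have density one (PERCENT-FULL (F2)) -/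

/-- In the family, `E_{A,B}` has (geometric) complex multiplication iff `j(E_{A,B})` is one of the
thirteen rational CM `j`-invariants — the tree THEOREM `WeierstrassCurve.hasCM_iff_j_mem_holds`
(Silverman, *AEC* App. C §11) read through `shortWeierstrass_j`; the paper's decomposition
`𝓔^cm = ∐_{j ∈ 𝓙^cm} 𝓔_j` over the thirteen CM `j`-invariants (§2, before Thm 2.4).
[cite: BarqueroSanchezCalvoMonge2025, §2 (𝓔^cm = ∐_{j ∈ 𝓙^cm} 𝓔_j)] [cite: SilvermanAEC2009, Appendix C §11, Examples 11.3.1–11.3.2] -/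
theorem hasCM_shortWeierstrass_iff {AB : ℤ × ℤ} (hf : IsInHeightFamily AB) :
    (shortWeierstrass AB).HasCM ↔ shortWeierstrassJ AB ∈ cmJInvariants := by
  haveI := isElliptic_shortWeierstrass hf
  rw [← shortWeierstrass_j AB]
  exact WeierstrassCurve.hasCM_iff_j_mem_holds (shortWeierstrass AB)

/-- **At most `13·(2X³ + 1)` curves of height `< Y ≤ X⁶` have complex multiplication** (thirteen
`j`-invariants, `card_filter_shortWeierstrassJ_eq_le` each) — a CRUDE form of the paper's Thm 1.3,
`#𝓔^cm(X) = (2/(3^{3/2}ζ(6))) X^{1/2} + (2^{1/3}/ζ(4)) X^{1/3} + O(X^{1/6})` (asymptotics not formalised).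
[cite: BarqueroSanchezCalvoMonge2025, Thm 1.3 (crude upper bound only)] -/
theorem card_filter_hasCM_le {X Y : ℕ} (hYX : Y ≤ X ^ 6) :
    ((heightFamilyBelow Y).filter fun AB ↦ (shortWeierstrass AB).HasCM).card ≤
      13 * (2 * X ^ 3 + 1) := by
  calc ((heightFamilyBelow Y).filter fun AB ↦ (shortWeierstrass AB).HasCM).card
      ≤ (cmJInvariants.biUnion fun j₀ ↦
          (heightFamilyBelow Y).filter fun AB ↦ shortWeierstrassJ AB = j₀).card := by
        refine Finset.card_le_card fun AB h ↦ ?_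
        rw [Finset.mem_filter] at h
        have hf : IsInHeightFamily AB := ((mem_heightFamilyBelow_iff AB Y).mp h.1).1
        rw [Finset.mem_biUnion]
        exact ⟨_, (hasCM_shortWeierstrass_iff hf).mp h.2, Finset.mem_filter.mpr ⟨h.1, rfl⟩⟩
    _ ≤ ∑ j₀ ∈ cmJInvariants,
          ((heightFamilyBelow Y).filter fun AB ↦ shortWeierstrassJ AB = j₀).card :=
        Finset.card_biUnion_le
    _ ≤ ∑ _j₀ ∈ cmJInvariants, (2 * X ^ 3 + 1) :=
        Finset.sum_le_sum fun j₀ _ ↦ card_filter_shortWeierstrassJ_eq_le j₀ hYX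
    _ = 13 * (2 * X ^ 3 + 1) := by
        rw [Finset.sum_const, card_cmJInvariants, smul_eq_mul]

/-- **Barquero-Sanchez–Calvo-Monge, Thm 1.1 (= Thm 2.5): CM curves have natural density zero** — "The
natural density of the set of CM elliptic curves `𝓔^cm` in the family `𝓔` is
`d(𝓔^cm) = lim_{X → ∞} #𝓔^cm(X)/#𝓔(X) = 0`" — in the tree's normalisation (`h < X`, `X ∈ ℕ`), PROVED,
unconditionally: the classification of the thirteen rational CM `j`-invariants is the tree theorem
`WeierstrassCurve.hasCM_iff_j_mem_holds`. [cite: BarqueroSanchezCalvoMonge2025, Thm 1.1 (= Thm 2.5)] -/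
theorem hasHeightDensity_zero_hasCM :
    HasHeightDensity (fun AB ↦ (shortWeierstrass AB).HasCM) 0 :=
  hasHeightDensity_zero_of_card_filter_le 39 fun X Y hX hYX ↦ by
    have h : (((heightFamilyBelow Y).filter fun AB ↦ (shortWeierstrass AB).HasCM).card : ℝ)
        ≤ 13 * (2 * (X : ℝ) ^ 3 + 1) := by
      exact_mod_cast card_filter_hasCM_le hYX
    have hX' : (1 : ℝ) ≤ X := by exact_mod_cast hX
    have p3 : (X : ℝ) ^ 3 ≤ (X : ℝ) ^ 4 := pow_le_pow_right₀ hX' (by norm_num)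
    have p0 : (1 : ℝ) ≤ (X : ℝ) ^ 4 := one_le_pow₀ hX'
    linarith

/-- **Non-CM curves have (lower) height density one** (complement form of Thm 1.1, `d(𝓔^cm) = 0`) —
PERCENT-FULL.md §(ii).2 (F2), in the kernel and unconditional. [cite: BarqueroSanchezCalvoMonge2025, Thm 1.1 (complement form)] -/
theorem heightDensityGE_one_not_hasCM :
    HeightDensityGE (fun AB ↦ ¬ (shortWeierstrass AB).HasCM) 1 :=
  hasHeightDensity_zero_hasCM.heightDensityGE_not_of_zero

/-- Removing the CM curves from a set of lower density `δ` keeps lower density `δ` (the algebra (L) of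
PERCENT-FULL.md §(ii).2 with `Z₂ = CM`). [cite: BarqueroSanchezCalvoMonge2025, Thm 1.1 (d(𝓔^cm) = 0)] [cite: BhargavaSkinnerZhang2014, §3 (discarding a density-zero set)] -/
theorem HeightDensityGE.and_not_hasCM {P : ℤ × ℤ → Prop} {δ : ℝ} (hP : HeightDensityGE P δ) :
    HeightDensityGE (fun AB ↦ P AB ∧ ¬ (shortWeierstrass AB).HasCM) δ :=
  hP.and_of_one heightDensityGE_one_not_hasCM

end Literature.NumberTheory.EllipticCurves
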